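import Summits.KontsevichZagierPeriods.KontsevichZagierPeriods.Theses.TerasomaMultiplication
import Literature.NumberTheory.Transcendental.KZBetaChains
import Literature.NumberTheory.Transcendental.KZDirichletScaling
import Literature.NumberTheory.Transcendental.KZSemialgebraicComplex
import Literature.NumberTheory.Transcendental.SemialgebraicMapsProofs
import Literature.NumberTheory.Transcendental.KZCalculusProofs
import Mathlib.MeasureTheory.Function.LocallyIntegrable

/-!
# `CompleteModGammaSector` (stmt-KontsevichZagierPeriods-14233) — line `line-wolfart-collapses-to-huber-wustholz`,
stubs `stub_eulerInvolutionMove` + `stub_eulerTransformedRep` (registered skeleton b56afbf50b76, lead c1)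

**Euler's transformation as ONE move of the Kontsevich–Zagier calculus.** For rational `a`,
`0 < b < c`, a real algebraic `λ ∈ (0,1)` and a real algebraic constant `α`, the Euler integral
representation `[(0,1), α t^{b−1}(1−t)^{c−b−1}(1−λt)^{−a}]` of `α·B(b,c−b)·₂F₁(a,b;c;λ)` is
KZ-equivalent to `[(0,1), α' t^{c−b−1}(1−t)^{b−1}(1−λt)^{−(c−a)}]` with the algebraic constant
`α' = α (1−λ)^{c−a−b}` — Euler's transformation `₂F₁(a,b;c;λ) = (1−λ)^{c−a−b} ₂F₁(c−a,c−b;c;λ)`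
(Andrews–Askey–Roy, Thm. 2.2.5) read inside rule (2): the substitution `u = (1−t)/(1−λt)` is an
INVOLUTION of `(0,1)` (`euler_moeb_moeb`) with `1 − u = (1−λ)t/(1−λt)`, `1 − λu = (1−λ)/(1−λt)`,
`|du/dt| = (1−λ)/(1−λt)²` (`KZ.det_smul_id_fin`), and the pull-back identity is the exponent bookkeeping
`pullback_core` (an identity between monomials in four free positive quantities, proved through
`Real.log`). The chart `Φ(x) = (u(x₀))` of `ℝ¹` is a `ℚ`-semialgebraic map (the coefficient `λ` is a
real algebraic constant, `isSemialgebraicFunOn_const_of_isAlgebraic`), the transformed integrand is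
`ℚ`-semialgebraic on `(0,1)` (`isSemialgebraicFunOn_eulerIntegrand`: Euler–Mellin monomial times a
rational power of the `ℚ(λ)`-linear form `1 − λt`, by composition), and its absolute integrability is
transported from that of the given representation by Mathlib's Jacobian criterion
`MeasureTheory.integrableOn_image_iff_integrableOn_abs_det_fderiv_smul` is not even needed: the move is stated for
two GIVEN representations (`stub_eulerInvolutionMove`), and the transformed representation EXISTS
(`stub_eulerTransformedRep`) because the Euler integrand is a Beta kernel `t^{(c−b)−1}(1−t)^{b−1}`
(integrable for `0 < b < c`, `Selberg.integrableOn_Ioo_rpow_mul_one_sub_rpow_and_integral_eq`) times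
the factor `(1−λt)^{−(c−a)}`, continuous on `[0,1]`. No definition is introduced: the second
representation is assembled inside the proof. Pattern of
`TerasomaMultiplicationBetaCancellationStubMoebiusMove.lean`; the `∃`-form
`eulerTransformationMove` of the line's glue follows from the two stubs in three lines (skeleton).

References: G. Andrews, R. Askey, R. Roy, *Special Functions* (1999), Thm. 2.2.5 and (2.2.6);
M. Kontsevich, D. Zagier, *Periods* (2001), §1.2 rule (2).
-/

noncomputable section

-- `Summit.KontsevichZagierPeriods.KontsevichZagierPeriods.…` is the tree's mandated layout (single-conjunct summit).
set_option linter.dupNamespace false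

namespace Summit.KontsevichZagierPeriods.KontsevichZagierPeriods.CompleteModGammaSectorLine

open MeasureTheory Set
open Literature.NumberTheory.Transcendental
open Literature.NumberTheory.Transcendental.KZ
open Literature.ModelTheory.ExponentialFields (IsSemialgebraic isSemialgebraic_setOf_eval_pos)
open MvPolynomial (aeval X C)

/-! ## Scalar algebra of the involution `u(t) = (1 − t)/(1 − λt)` -/

/-- The denominator `1 − λt` is positive on `t ≤ 1` for `0 < λ < 1`. [folklore] -/
theorem euler_den_pos {lam t : ℝ} (hl0 : 0 < lam) (hl1 : lam < 1) (ht : t ≤ 1) : 0 < 1 - lam * t := by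
  nlinarith

/-- `u(t) ∈ (0,1)` for `t ∈ (0,1)`. [folklore] -/
theorem euler_moeb_mem {lam t : ℝ} (hl0 : 0 < lam) (hl1 : lam < 1) (ht : t ∈ Ioo (0:ℝ) 1) :
    (1 - t) / (1 - lam * t) ∈ Ioo (0:ℝ) 1 := by
  have hD := euler_den_pos hl0 hl1 ht.2.le
  refine ⟨div_pos (by linarith [ht.2]) hD, ?_⟩
  rw [div_lt_one hD]
  nlinarith [ht.1]

/-- `1 − u(t) = (1 − λ) t / (1 − λt)`. [folklore] -/
theorem one_sub_euler_moeb {lam t : ℝ} (hD : 1 - lam * t ≠ 0) :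
    1 - (1 - t) / (1 - lam * t) = (1 - lam) * t / (1 - lam * t) := by
  rw [eq_div_iff hD, sub_mul, one_mul, div_mul_cancel₀ _ hD]
  ring

/-- `1 − λ u(t) = (1 − λ)/(1 − λt)`. [folklore] -/
theorem one_sub_mul_euler_moeb {lam t : ℝ} (hD : 1 - lam * t ≠ 0) :
    1 - lam * ((1 - t) / (1 - lam * t)) = (1 - lam) / (1 - lam * t) := by
  rw [eq_div_iff hD, sub_mul, one_mul, mul_assoc, div_mul_cancel₀ _ hD]
  ring

/-- `u` is an involution: `u(u(t)) = t` (for `λ ≠ 1`, off the pole). [folklore] -/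
theorem euler_moeb_moeb {lam t : ℝ} (hl1 : lam ≠ 1) (hD : 1 - lam * t ≠ 0) :
    (1 - (1 - t) / (1 - lam * t)) / (1 - lam * ((1 - t) / (1 - lam * t))) = t := by
  rw [one_sub_euler_moeb hD, one_sub_mul_euler_moeb hD, div_div_div_cancel_right₀ hD,
    mul_div_cancel_left₀ _ (sub_ne_zero.mpr (Ne.symm hl1))]

/-- `u'(t) = −(1 − λ)/(1 − λt)²` (quotient rule). [folklore] -/
theorem hasDerivAt_euler_moeb {lam t : ℝ} (hD : 1 - lam * t ≠ 0) :
    HasDerivAt (fun s : ℝ => (1 - s) / (1 - lam * s)) (-(1 - lam) / (1 - lam * t) ^ 2) t := by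
  have h1 : HasDerivAt (fun s : ℝ => 1 - s) (-1) t := by
    simpa using (hasDerivAt_id t).const_sub 1
  have h2 : HasDerivAt (fun s : ℝ => 1 - lam * s) (-lam) t := by
    simpa using ((hasDerivAt_id t).const_mul lam).const_sub 1
  refine (h1.div h2 hD).congr_deriv ?_
  ring

/-- **The pull-back bookkeeping**, an identity between monomials in four free positive quantities
`L = 1 − λ`, `D = 1 − λt`, `t`, `s = 1 − t`:
`L^{C−A−B} · (s/D)^{C−B−1} (Lt/D)^{B−1} (L/D)^{−(C−A)} · L/D² = t^{B−1} s^{C−B−1} D^{−A}`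
(the exponent of `L` is `0`, that of `D` is `−A`); proved by taking logarithms. [folklore] -/
theorem pullback_core (L D t s A B C : ℝ) (hL : 0 < L) (hD : 0 < D) (ht : 0 < t) (hs : 0 < s) :
    L ^ (C - A - B) * ((s / D) ^ (C - B - 1) * (L * t / D) ^ (B - 1) * (L / D) ^ (-(C - A))) *
        (L / D ^ 2) = t ^ (B - 1) * s ^ (C - B - 1) * D ^ (-A) := by
  have hlhs : 0 < L ^ (C - A - B) * ((s / D) ^ (C - B - 1) * (L * t / D) ^ (B - 1) *
      (L / D) ^ (-(C - A))) * (L / D ^ 2) := by positivity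
  have hrhs : 0 < t ^ (B - 1) * s ^ (C - B - 1) * D ^ (-A) := by positivity
  refine Real.log_injOn_pos (Set.mem_Ioi.2 hlhs) (Set.mem_Ioi.2 hrhs) ?_
  have e1 : Real.log (s / D) = Real.log s - Real.log D := Real.log_div hs.ne' hD.ne'
  have e2 : Real.log (L * t / D) = Real.log L + Real.log t - Real.log D := by
    rw [Real.log_div (mul_pos hL ht).ne' hD.ne', Real.log_mul hL.ne' ht.ne']
  have e3 : Real.log (L / D) = Real.log L - Real.log D := Real.log_div hL.ne' hD.ne'
  have e4 : Real.log (L / D ^ 2) = Real.log L - 2 * Real.log D := by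
    rw [Real.log_div hL.ne' (pow_pos hD 2).ne', Real.log_pow]
    push_cast
    ring
  have hX1 : 0 < L ^ (C - A - B) := Real.rpow_pos_of_pos hL _
  have hX2 : 0 < (s / D) ^ (C - B - 1) := Real.rpow_pos_of_pos (div_pos hs hD) _
  have hX3 : 0 < (L * t / D) ^ (B - 1) := Real.rpow_pos_of_pos (div_pos (mul_pos hL ht) hD) _
  have hX4 : 0 < (L / D) ^ (-(C - A)) := Real.rpow_pos_of_pos (div_pos hL hD) _
  have hX5 : 0 < L / D ^ 2 := div_pos hL (pow_pos hD 2)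
  have hY1 : 0 < t ^ (B - 1) := Real.rpow_pos_of_pos ht _
  have hY2 : 0 < s ^ (C - B - 1) := Real.rpow_pos_of_pos hs _
  have hY3 : 0 < D ^ (-A) := Real.rpow_pos_of_pos hD _
  rw [Real.log_mul (mul_pos hX1 (mul_pos (mul_pos hX2 hX3) hX4)).ne' hX5.ne',
    Real.log_mul hX1.ne' (mul_pos (mul_pos hX2 hX3) hX4).ne',
    Real.log_mul (mul_pos hX2 hX3).ne' hX4.ne', Real.log_mul hX2.ne' hX3.ne',
    Real.log_mul (mul_pos hY1 hY2).ne' hY3.ne', Real.log_mul hY1.ne' hY2.ne',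
    Real.log_rpow hL, Real.log_rpow (div_pos hs hD), Real.log_rpow (div_pos (mul_pos hL ht) hD),
    Real.log_rpow (div_pos hL hD), Real.log_rpow ht, Real.log_rpow hs, Real.log_rpow hD,
    e1, e2, e3, e4]
  ring

/-! ## The chart `Φ(x) = (u(x₀))` of `ℝ¹` -/

/-- `Φ` has derivative `u'(x₀) • id` off the pole (chain rule through the coordinate `x₀`).
[folklore] -/
theorem euler_hasFDerivAt {lam : ℝ} {x : Fin 1 → ℝ} (hD : 1 - lam * x 0 ≠ 0) :
    HasFDerivAt (fun y : Fin 1 → ℝ => fun _ : Fin 1 => (1 - y 0) / (1 - lam * y 0))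
      ((-(1 - lam) / (1 - lam * x 0) ^ 2) • ContinuousLinearMap.id ℝ (Fin 1 → ℝ)) x := by
  rw [hasFDerivAt_pi']
  intro i
  obtain rfl : i = 0 := Fin.fin_one_eq_zero i
  have h0 : HasFDerivAt (fun f : Fin 1 → ℝ => f 0)
      (ContinuousLinearMap.proj (R := ℝ) (φ := fun _ : Fin 1 => ℝ) 0) x :=
    hasFDerivAt_apply 0 x
  refine ((hasDerivAt_euler_moeb hD).comp_hasFDerivAt x h0).congr_fderiv
    (ContinuousLinearMap.ext fun v => ?_)
  simp

/-- `Φ` is an involution of `{x | x₀ ∈ (0,1)}` (coordinatewise `euler_moeb_moeb`). [folklore] -/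
theorem euler_chart_chart {lam : ℝ} (hl0 : 0 < lam) (hl1 : lam < 1) {x : Fin 1 → ℝ}
    (hx : x 0 ∈ Ioo (0:ℝ) 1) :
    (fun _ : Fin 1 => (1 - (1 - x 0) / (1 - lam * x 0)) / (1 - lam * ((1 - x 0) / (1 - lam * x 0)))) =
      x := by
  funext i
  obtain rfl : i = 0 := Fin.fin_one_eq_zero i
  exact euler_moeb_moeb hl1.ne (euler_den_pos hl0 hl1 hx.2.le).ne'

/-- `Φ` is injective on `{x | x₀ ∈ (0,1)}` (an involution there). [folklore] -/
theorem euler_injOn {lam : ℝ} (hl0 : 0 < lam) (hl1 : lam < 1) :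
    InjOn (fun y : Fin 1 → ℝ => fun _ : Fin 1 => (1 - y 0) / (1 - lam * y 0))
      {x : Fin 1 → ℝ | x 0 ∈ Ioo (0:ℝ) 1} := by
  intro x hx y hy hxy
  have h0 : (1 - x 0) / (1 - lam * x 0) = (1 - y 0) / (1 - lam * y 0) := congrFun hxy 0
  have hx' : x 0 ∈ Ioo (0:ℝ) 1 := hx
  have hy' : y 0 ∈ Ioo (0:ℝ) 1 := hy
  funext i
  obtain rfl : i = 0 := Fin.fin_one_eq_zero i
  calc x 0 = (1 - (1 - x 0) / (1 - lam * x 0)) / (1 - lam * ((1 - x 0) / (1 - lam * x 0))) :=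
        (euler_moeb_moeb hl1.ne (euler_den_pos hl0 hl1 hx'.2.le).ne').symm
    _ = (1 - (1 - y 0) / (1 - lam * y 0)) / (1 - lam * ((1 - y 0) / (1 - lam * y 0))) := by rw [h0]
    _ = y 0 := euler_moeb_moeb hl1.ne (euler_den_pos hl0 hl1 hy'.2.le).ne'

/-- `Φ` maps `{x | x₀ ∈ (0,1)}` ONTO itself (into by `euler_moeb_mem`, onto by the involution).
[folklore] -/
theorem euler_image {lam : ℝ} (hl0 : 0 < lam) (hl1 : lam < 1) :
    (fun y : Fin 1 → ℝ => fun _ : Fin 1 => (1 - y 0) / (1 - lam * y 0)) ''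
        {x : Fin 1 → ℝ | x 0 ∈ Ioo (0:ℝ) 1} = {x : Fin 1 → ℝ | x 0 ∈ Ioo (0:ℝ) 1} := by
  ext y
  constructor
  · rintro ⟨x, hx, rfl⟩
    have hx' : x 0 ∈ Ioo (0:ℝ) 1 := hx
    show (1 - x 0) / (1 - lam * x 0) ∈ Ioo (0:ℝ) 1
    exact euler_moeb_mem hl0 hl1 hx'
  · intro hy
    have hy' : y 0 ∈ Ioo (0:ℝ) 1 := hy
    refine ⟨fun _ : Fin 1 => (1 - y 0) / (1 - lam * y 0), ?_, ?_⟩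
    · show (1 - y 0) / (1 - lam * y 0) ∈ Ioo (0:ℝ) 1
      exact euler_moeb_mem hl0 hl1 hy'
    · exact euler_chart_chart hl0 hl1 hy'

/-- `Φ` is a `ℚ`-semialgebraic map on any `ℚ`-semialgebraic set off the pole: `λ` is real
algebraic, so the constant `λ` is a `ℚ`-semialgebraic function
(`isSemialgebraicFunOn_const_of_isAlgebraic`), and the class is closed under `−, *, /`.
[cite: BochnakCosteRoy1998, Prop. 2.2.6] -/
theorem euler_isSemialgebraicMapOn {lam : ℝ} (hlam : IsAlgebraic ℚ lam) {σ : Set (Fin 1 → ℝ)}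
    (hσ : IsSemialgebraic ℚ σ) (h0 : ∀ x ∈ σ, 1 - lam * x 0 ≠ 0) :
    IsSemialgebraicMapOn ℚ σ (fun y : Fin 1 → ℝ => fun _ : Fin 1 => (1 - y 0) / (1 - lam * y 0)) := by
  have hl' : IsSemialgebraicFunOn ℚ σ (fun _ => lam) := isSemialgebraicFunOn_const_of_isAlgebraic hσ hlam
  have h1 : IsSemialgebraicFunOn ℚ σ (fun _ => (1:ℝ)) :=
    (isSemialgebraicFunOn_aeval hσ (1 : MvPolynomial (Fin 1) ℚ)).congr fun x _ => by simp
  have hx : IsSemialgebraicFunOn ℚ σ (fun x => x 0) :=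
    (isSemialgebraicFunOn_aeval hσ (X 0)).congr fun x _ => by simp
  have hnum : IsSemialgebraicFunOn ℚ σ (fun x => 1 - x 0) :=
    (IsSemialgebraicFunOn.sub_holds h1 hx).congr fun x _ => rfl
  have hden : IsSemialgebraicFunOn ℚ σ (fun x => 1 - lam * x 0) :=
    (IsSemialgebraicFunOn.sub_holds h1 (IsSemialgebraicFunOn.mul_holds hl' hx)).congr fun x _ => rfl
  exact IsSemialgebraicMapOn.of_forall hσ fun _ => hnum.div hden h0

/-! ## The Euler integrand is `ℚ`-semialgebraic on `(0,1)`; its constant is algebraic -/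

/-- `y ↦ y₀^e` (`e ∈ ℚ`) is `ℚ`-semialgebraic on `{y | 0 < y₀} ⊆ ℝ¹` (one-factor Euler–Mellin
monomial, `KZ.isSemialgebraicFunOn_mellinIntegrand`). [cite: KontsevichZagier2001, §1.1] -/
theorem isSemialgebraicFunOn_rpow_coord (e : ℚ) :
    IsSemialgebraicFunOn ℚ {y : Fin 1 → ℝ | 0 < y 0} (fun y => (y 0) ^ ((e : ℚ) : ℝ)) := by
  have hT : IsSemialgebraic ℚ {y : Fin 1 → ℝ | 0 < y 0} := by
    simpa using isSemialgebraic_setOf_eval_pos (k := ℚ) (R := ℝ) (X 0 : MvPolynomial (Fin 1) ℚ)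
  refine (isSemialgebraicFunOn_mellinIntegrand hT ![X 0] ![e] 1 fun y hy k => ?_).congr
    fun y _ => ?_
  · have hy' : 0 < y 0 := hy
    fin_cases k
    simpa using hy'
  · simp [mellinIntegrand_apply]

/-- **The Euler integrand is `ℚ`-semialgebraic**: for real algebraic `α`, `λ` with `0 < λ < 1` and
rational exponents `p, q, e`, the function `α · x₀^p (1 − x₀)^q (1 − λx₀)^e` is `ℚ`-semialgebraic on
`{x | x₀ ∈ (0,1)}` — an Euler–Mellin monomial times the composite of `y ↦ y^e` with the
`ℚ`-semialgebraic map `x ↦ 1 − λx₀ > 0`. [cite: KontsevichZagier2001, §1.1] -/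
theorem isSemialgebraicFunOn_eulerIntegrand {α lam : ℝ} (hα : IsAlgebraic ℚ α)
    (hlam : IsAlgebraic ℚ lam) (hl0 : 0 < lam) (hl1 : lam < 1) (p q e : ℚ) :
    IsSemialgebraicFunOn ℚ {x : Fin 1 → ℝ | x 0 ∈ Ioo (0:ℝ) 1}
      (fun x => α * (x 0) ^ ((p : ℚ) : ℝ) * (1 - x 0) ^ ((q : ℚ) : ℝ) * (1 - lam * x 0) ^ ((e : ℚ) : ℝ)) := by
  have hs : IsSemialgebraic ℚ {x : Fin 1 → ℝ | x 0 ∈ Ioo (0:ℝ) 1} := BallPeeling.isSemialgebraic_posIoo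
  have hden : ∀ x ∈ {x : Fin 1 → ℝ | x 0 ∈ Ioo (0:ℝ) 1}, 0 < 1 - lam * x 0 := fun x hx =>
    euler_den_pos hl0 hl1 (le_of_lt hx.2)
  -- the Euler–Mellin monomial `x₀^p (1 − x₀)^q`
  have hmon : IsSemialgebraicFunOn ℚ {x : Fin 1 → ℝ | x 0 ∈ Ioo (0:ℝ) 1}
      (fun x => (x 0) ^ ((p : ℚ) : ℝ) * (1 - x 0) ^ ((q : ℚ) : ℝ)) :=
    (isSemialgebraicFunOn_const_mul_rpow_mul_rpow 1 p q).congr fun x _ => by simp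
  -- the factor `(1 − λx₀)^e` as a composite
  have hl' : IsSemialgebraicFunOn ℚ {x : Fin 1 → ℝ | x 0 ∈ Ioo (0:ℝ) 1} (fun _ => lam) :=
    isSemialgebraicFunOn_const_of_isAlgebraic hs hlam
  have h1 : IsSemialgebraicFunOn ℚ {x : Fin 1 → ℝ | x 0 ∈ Ioo (0:ℝ) 1} (fun _ => (1:ℝ)) :=
    (isSemialgebraicFunOn_aeval hs (1 : MvPolynomial (Fin 1) ℚ)).congr fun x _ => by simp
  have hx : IsSemialgebraicFunOn ℚ {x : Fin 1 → ℝ | x 0 ∈ Ioo (0:ℝ) 1} (fun x => x 0) :=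
    (isSemialgebraicFunOn_aeval hs (X 0)).congr fun x _ => by simp
  have hlin : IsSemialgebraicFunOn ℚ {x : Fin 1 → ℝ | x 0 ∈ Ioo (0:ℝ) 1} (fun x => 1 - lam * x 0) :=
    (IsSemialgebraicFunOn.sub_holds h1 (IsSemialgebraicFunOn.mul_holds hl' hx)).congr fun x _ => rfl
  have hF : IsSemialgebraicMapOn ℚ {x : Fin 1 → ℝ | x 0 ∈ Ioo (0:ℝ) 1}
      (fun x : Fin 1 → ℝ => fun _ : Fin 1 => 1 - lam * x 0) :=
    IsSemialgebraicMapOn.of_forall hs fun _ => hlin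
  have hmaps : MapsTo (fun x : Fin 1 → ℝ => fun _ : Fin 1 => 1 - lam * x 0)
      {x : Fin 1 → ℝ | x 0 ∈ Ioo (0:ℝ) 1} {y : Fin 1 → ℝ | 0 < y 0} := fun x hx => hden x hx
  have hfac : IsSemialgebraicFunOn ℚ {x : Fin 1 → ℝ | x 0 ∈ Ioo (0:ℝ) 1}
      (fun x => (1 - lam * x 0) ^ ((e : ℚ) : ℝ)) :=
    (IsSemialgebraicFunOn.comp_isSemialgebraicMapOn_holds (isSemialgebraicFunOn_rpow_coord e) hF
      hmaps).congr fun x _ => rfl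
  have hαc : IsSemialgebraicFunOn ℚ {x : Fin 1 → ℝ | x 0 ∈ Ioo (0:ℝ) 1} (fun _ => α) :=
    isSemialgebraicFunOn_const_of_isAlgebraic hs hα
  exact (IsSemialgebraicFunOn.mul_holds (IsSemialgebraicFunOn.mul_holds hαc hmon) hfac).congr
    fun x _ => by simp only [Pi.mul_apply]; ring

/-- `x^r` is algebraic for a positive real algebraic `x` and rational `r` (`(x^r)^{den r} = x^{num r}`).
[folklore] -/
theorem isAlgebraic_rpow_rat {x : ℝ} (hx : IsAlgebraic ℚ x) (hpos : 0 < x) (r : ℚ) :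
    IsAlgebraic ℚ (x ^ (r : ℝ)) := by
  have hden : 0 < r.den := r.den_pos
  refine IsAlgebraic.of_pow hden ?_
  rw [← Real.rpow_natCast, ← Real.rpow_mul hpos.le, show (r : ℝ) * (r.den : ℕ) = (r.num : ℤ) by
    rw [show ((r.den : ℕ) : ℝ) = ((r.den : ℚ) : ℝ) by push_cast; rfl,
      show ((r.num : ℤ) : ℝ) = ((r.num : ℚ) : ℝ) by push_cast; rfl, ← Rat.cast_mul,
      Rat.mul_den_eq_num], Real.rpow_intCast]
  rcases Int.natAbs_eq r.num with h | h <;> rw [h]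
  · rw [zpow_natCast]; exact hx.pow _
  · rw [zpow_neg, zpow_natCast]; exact (hx.pow _).inv


/-! ## The stubs -/

/-- **Registered stub `stub_eulerInvolutionMove`** (line `wolfart-collapses-to-huber-wustholz` of crux
stmt-KontsevichZagierPeriods-14233): Euler's transformation
`₂F₁(a,b;c;λ) = (1−λ)^{c−a−b} ₂F₁(c−a,c−b;c;λ)` inside the Kontsevich–Zagier calculus — for any two
representations pinned to `[(0,1), α t^{b−1}(1−t)^{c−b−1}(1−λt)^{−a}]` and
`[(0,1), α(1−λ)^{c−a−b} t^{c−b−1}(1−t)^{b−1}(1−λt)^{−(c−a)}]`, `[r] − [r']` is ONE change-of-variables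
move `t ↦ (1−t)/(1−λt)` (source `r`). The hypotheses `0 < b`, `b < c`, `IsAlgebraic ℚ α` are not used
(both representations are given). [cite: AndrewsAskeyRoy1999, Thm 2.2.5] -/
theorem stub_eulerInvolutionMove : ∀ (a b c : ℚ) (lam α : ℝ), 0 < b → b < c → 0 < lam → lam < 1 →
    IsAlgebraic ℚ lam → IsAlgebraic ℚ α → ∀ (r r' : IntegralRep 1),
    r.domain = {t | t 0 ∈ Set.Ioo (0:ℝ) 1} →
    Set.EqOn r.integrand (fun t => α * (t 0) ^ ((b : ℝ) - 1) * (1 - t 0) ^ ((c : ℝ) - (b : ℝ) - 1) *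
      (1 - lam * t 0) ^ (-(a : ℝ))) r.domain →
    r'.domain = {t | t 0 ∈ Set.Ioo (0:ℝ) 1} →
    Set.EqOn r'.integrand (fun t => (α * (1 - lam) ^ ((c : ℝ) - (a : ℝ) - (b : ℝ))) *
      (t 0) ^ ((c : ℝ) - (b : ℝ) - 1) * (1 - t 0) ^ ((b : ℝ) - 1) *
      (1 - lam * t 0) ^ (-((c : ℝ) - (a : ℝ)))) r'.domain →
    Equivalent r r' := by
  intro a b c lam α _ _ hl0 hl1 hlam _ r r' hrd hri hr'd hr'i
  have hS : IsSemialgebraic ℚ {x : Fin 1 → ℝ | x 0 ∈ Ioo (0:ℝ) 1} := BallPeeling.isSemialgebraic_posIoo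
  have hL : 0 < 1 - lam := sub_pos.mpr hl1
  have hden : ∀ x ∈ {x : Fin 1 → ℝ | x 0 ∈ Ioo (0:ℝ) 1}, 0 < 1 - lam * x 0 := fun x hx =>
    euler_den_pos hl0 hl1 (le_of_lt hx.2)
  -- ONE change-of-variables move (source `r`, target `r'`)
  refine changeOfVariablesRel_subset_relations
    ⟨1, r, r', fun y : Fin 1 → ℝ => fun _ : Fin 1 => (1 - y 0) / (1 - lam * y 0),
      fun x => (-(1 - lam) / (1 - lam * x 0) ^ 2) • ContinuousLinearMap.id ℝ (Fin 1 → ℝ),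
      ?_, ?_, ?_, ?_, fun x hx => ?_, rfl⟩
  · rw [hrd]
    exact euler_isSemialgebraicMapOn hlam hS fun x hx => (hden x hx).ne'
  · rw [hrd]
    exact fun x hx => (euler_hasFDerivAt (hden x hx).ne').hasFDerivWithinAt
  · rw [hrd]
    exact euler_injOn hl0 hl1
  · rw [hr'd, hrd, euler_image hl0 hl1]
  · -- the pull-back identity at `x ∈ (0,1)`, Jacobian `|det Φ'| = (1−λ)/(1−λx₀)²` included
    have hx' : x 0 ∈ Ioo (0:ℝ) 1 := by rw [hrd] at hx; exact hx
    have hD := hden x hx'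
    have hΦx : (fun _ : Fin 1 => (1 - x 0) / (1 - lam * x 0)) ∈ r'.domain := by
      rw [hr'd]
      exact euler_moeb_mem hl0 hl1 hx'
    rw [hri hx, hr'i hΦx, det_smul_id_fin, pow_one, abs_div, abs_neg, abs_of_pos hL,
      abs_of_pos (pow_pos hD 2)]
    simp only
    rw [one_sub_euler_moeb hD.ne', one_sub_mul_euler_moeb hD.ne']
    have key := pullback_core (1 - lam) (1 - lam * x 0) (x 0) (1 - x 0) (a : ℝ) (b : ℝ) (c : ℝ) hL hD
      hx'.1 (sub_pos.mpr hx'.2)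
    calc α * (x 0) ^ ((b : ℝ) - 1) * (1 - x 0) ^ ((c : ℝ) - (b : ℝ) - 1) * (1 - lam * x 0) ^ (-(a : ℝ))
        = α * ((x 0) ^ ((b : ℝ) - 1) * (1 - x 0) ^ ((c : ℝ) - (b : ℝ) - 1) *
            (1 - lam * x 0) ^ (-(a : ℝ))) := by ring
      _ = α * ((1 - lam) ^ ((c : ℝ) - (a : ℝ) - (b : ℝ)) *
            (((1 - x 0) / (1 - lam * x 0)) ^ ((c : ℝ) - (b : ℝ) - 1) *
              ((1 - lam) * x 0 / (1 - lam * x 0)) ^ ((b : ℝ) - 1) *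
              ((1 - lam) / (1 - lam * x 0)) ^ (-((c : ℝ) - (a : ℝ)))) *
            ((1 - lam) / (1 - lam * x 0) ^ 2)) := by rw [key]
      _ = _ := by ring

/-- **Registered stub `stub_eulerTransformedRep`**: the transformed Euler representation EXISTS —
its constant `α(1−λ)^{c−a−b}` is algebraic (`isAlgebraic_rpow_rat`), its integrand is
`ℚ`-semialgebraic on `(0,1)` (`isSemialgebraicFunOn_eulerIntegrand`) and absolutely integrable there
(Beta kernel `t^{(c−b)−1}(1−t)^{b−1}`, `0 < b < c`, times `(1−λt)^{−(c−a)}`, continuous on `[0,1]`).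
The representation is assembled in place (no `def`). [cite: KontsevichZagier2001, §1.1] -/
theorem stub_eulerTransformedRep : ∀ (a b c : ℚ) (lam α : ℝ), 0 < b → b < c → 0 < lam → lam < 1 →
    IsAlgebraic ℚ lam → IsAlgebraic ℚ α →
    IsAlgebraic ℚ (α * (1 - lam) ^ ((c : ℝ) - (a : ℝ) - (b : ℝ))) ∧
    ∃ r' : IntegralRep 1, r'.domain = {t | t 0 ∈ Set.Ioo (0:ℝ) 1} ∧
      r'.integrand = (fun t => (α * (1 - lam) ^ ((c : ℝ) - (a : ℝ) - (b : ℝ))) *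
        (t 0) ^ ((c : ℝ) - (b : ℝ) - 1) * (1 - t 0) ^ ((b : ℝ) - 1) *
        (1 - lam * t 0) ^ (-((c : ℝ) - (a : ℝ)))) := by
  intro a b c lam α hb hbc hl0 hl1 hlam hα
  have hS : IsSemialgebraic ℚ {x : Fin 1 → ℝ | x 0 ∈ Ioo (0:ℝ) 1} := BallPeeling.isSemialgebraic_posIoo
  have hL : 0 < 1 - lam := sub_pos.mpr hl1
  -- the algebraic constant
  have hα' : IsAlgebraic ℚ (α * (1 - lam) ^ ((c : ℝ) - (a : ℝ) - (b : ℝ))) := by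
    have h := isAlgebraic_rpow_rat (isAlgebraic_one.sub hlam) hL (c - a - b)
    push_cast at h
    exact hα.mul h
  -- semialgebraicity of the transformed integrand
  have hG : IsSemialgebraicFunOn ℚ {x : Fin 1 → ℝ | x 0 ∈ Ioo (0:ℝ) 1}
      (fun t : Fin 1 → ℝ => α * (1 - lam) ^ ((c : ℝ) - (a : ℝ) - (b : ℝ)) *
        (t 0) ^ ((c : ℝ) - (b : ℝ) - 1) * (1 - t 0) ^ ((b : ℝ) - 1) *
        (1 - lam * t 0) ^ (-((c : ℝ) - (a : ℝ)))) := by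
    have h := isSemialgebraicFunOn_eulerIntegrand hα' hlam hl0 hl1 (c - b - 1) (b - 1) (-(c - a))
    refine h.congr fun x _ => ?_
    push_cast
    ring_nf
  -- integrability: Beta kernel times a factor continuous on `[0,1]`, read on `ℝ` first
  have hbeta : IntegrableOn (fun u : ℝ => u ^ (((c : ℝ) - (b : ℝ)) - 1) * (1 - u) ^ ((b : ℝ) - 1))
      (Ioo (0:ℝ) 1) :=
    (Literature.Analysis.SpecialFunctions.Selberg.integrableOn_Ioo_rpow_mul_one_sub_rpow_and_integral_eq
      (by exact_mod_cast sub_pos.mpr hbc) (by exact_mod_cast hb)).1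
  have hcont : ContinuousOn (fun u : ℝ => (1 - lam * u) ^ (-((c : ℝ) - (a : ℝ)))) (Icc (0:ℝ) 1) :=
    ContinuousOn.rpow_const (by fun_prop) fun u hu => Or.inl (euler_den_pos hl0 hl1 hu.2).ne'
  have hprod := (hbeta.mul_continuousOn_of_subset hcont measurableSet_Ioo isCompact_Icc
    Ioo_subset_Icc_self).const_mul (α * (1 - lam) ^ ((c : ℝ) - (a : ℝ) - (b : ℝ)))
  have hint : IntegrableOn
      (fun t : Fin 1 → ℝ => α * (1 - lam) ^ ((c : ℝ) - (a : ℝ) - (b : ℝ)) *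
        (t 0) ^ ((c : ℝ) - (b : ℝ) - 1) * (1 - t 0) ^ ((b : ℝ) - 1) *
        (1 - lam * t 0) ^ (-((c : ℝ) - (a : ℝ)))) {x : Fin 1 → ℝ | x 0 ∈ Ioo (0:ℝ) 1} := by
    have h := (integrableOn_setOf_apply_mem_iff (S := Ioo (0:ℝ) 1)
      (g := fun u : ℝ => α * (1 - lam) ^ ((c : ℝ) - (a : ℝ) - (b : ℝ)) *
        (u ^ (((c : ℝ) - (b : ℝ)) - 1) * (1 - u) ^ ((b : ℝ) - 1) *
          (1 - lam * u) ^ (-((c : ℝ) - (a : ℝ)))))).mpr hprod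
    refine h.congr_fun (fun x _ => ?_)
      (Literature.ModelTheory.ExponentialFields.IsSemialgebraic.measurableSet_holds hS)
    simp only
    ring
  exact ⟨hα', ⟨{x : Fin 1 → ℝ | x 0 ∈ Ioo (0:ℝ) 1},
    fun t : Fin 1 → ℝ => α * (1 - lam) ^ ((c : ℝ) - (a : ℝ) - (b : ℝ)) *
      (t 0) ^ ((c : ℝ) - (b : ℝ) - 1) * (1 - t 0) ^ ((b : ℝ) - 1) *
      (1 - lam * t 0) ^ (-((c : ℝ) - (a : ℝ))), hS, hG, hint⟩, rfl, rfl⟩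

end Summit.KontsevichZagierPeriods.KontsevichZagierPeriods.CompleteModGammaSectorLine
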